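import Summits.BirchSwinnertonDyer.BirchSwinnertonDyer.Theses.TangentCone
import Literature.NumberTheory.EllipticCurves.PAdicLFunction
import Literature.NumberTheory.EllipticCurves.HidaFamilyMembers
import Literature.NumberTheory.EllipticCurves.PadicSeriesEvaluation
import Literature.NumberTheory.EllipticCurves.PeriodRationality
import HarnessLib
import Literature.NumberTheory.EllipticCurves.TwoVariablePadicLFunction

/-!
# BirchSwinnertonDyer / TangentCone — crux `EdgeCap` (stmt-BirchSwinnertonDyer-17609), line
# `ratio_measure_strassmann` (skeleton v7), stub G `stub_twoVariableInterpolation`: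
# reduction to the Greenberg–Stevens / Kitagawa named fact

Stub G of the registered skeleton v7 of line `ratio_measure_strassmann`
(`Cruxes/EdgeCap/Lines/ratio_measure_strassmann.lean`, `EdgeCap_of : M → G → L → A2 → EdgeCap`)
is the PRINTED input of the line: the existence of the Greenberg–Stevens / Kitagawa two-variable
`p`-adic `L`-function `F ∈ ℤ_p⟦X, Y⟧` of the Hida branch through the newform `f_E` of an elliptic
curve `E/ℚ` (globally minimal `W`, conductor `N = W.conductorNorm ℤ`) at a prime `p ≥ 5` of good
ordinary reduction with surjective mod-`p` representation, under the isolation hypothesis (Br)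
("no other ordinary weight-`2` newform of level dividing `Np` is congruent to `E` modulo `p`",
which makes the branch `𝕀 = Λ = ℤ_p⟦X⟧`), together with

* (wt 2) its weight-`2` fibre `F(0, T) = c · L_p(f_E, α, T)`, `c ≠ 0`, against the tree's
  Mazur–Swinnerton-Dyer / Mazur–Tate–Teitelbaum `padicLFunction f (unitRoot W p)`, and
* (interp) the interpolation formula at the classical points `(k, n)` — `k > 2`,
  `k ≡ 2 (mod p−1)`, `n` odd, `0 < n < k/2`, `n ≡ 1 (mod p−1)` — for EVERY ordinary newform
  `g ∈ S_k(Γ₀(N))` congruent to `E` away from `Np` (the weight-`k` member of the branch), in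
  VALUE–NORM form with the explicit unit-root Euler factor `(1 − p^{n−1}/α)(1 − p^{k−1−n}/α)` and
  existential periods (`p`-adic `Ω` = Kitagawa's `Per_{𝕀,λ_P}` up to an algebraic unit of
  normalisation, complex `ω` = a Shimura period of `g`).

Hida theory, `Λ`-adic modular symbols and the two-variable measure are NOT in Mathlib or in the
tree (searched `twoVariable`, `GreenbergStevens`, `Kitagawa`, `hidaFamily`, `LambdaAdic`: only the
anticyclotomic receptacle `TwoVariablePAdicLFunctionK.lean` and the classical-member fact
`HidaFamilyMembers.lean` exist), so the stub cannot be proved here. Following the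
NEED-A-PUBLISHED-FACT rule, this file

* STATES the printed theorem (Greenberg–Stevens 1993, Thm. 5.15; Kitagawa 1994, Thm. 1.1 and
  Prop. 5.12; as recalled in Delbourgo 2008, Thm. 4.11, Def. 4.12, Def. 4.9, Prop. 4.10 and p. 100;
  Hida 1986 control; Mazur–Tate–Teitelbaum 1986, §I.14 at weight `2`), specialised to exactly what
  the stub consumes (trivial tame character, the `ω⁰` branch in both variables, odd `n` left of
  the centre, norms instead of values), as the named fact
  `greenbergStevens_kitagawa_twoVariable_interpolation` — a closed `def … : Prop` written with
  fully qualified tree names and no scoped notation, tagged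
  `[file NumberTheory/EllipticCurves/TwoVariablePadicLFunction]` for relocation next to
  `Literature/NumberTheory/EllipticCurves/PAdicLFunction.lean` and `HidaFamilyMembers.lean`; its
  docstring carries the source statements and the derivation of each clause as printed;
* PROVES the stub conditionally on it: `stub_twoVariableInterpolation_of_fact`, in the colon
  form `greenbergStevens_kitagawa_twoVariable_interpolation → (<stub_twoVariableInterpolation
  verbatim>) := fun h => h` registered as a sub-goal stub of the crux item (so
  `stub_twoVariableInterpolation_of_fact h` is the registered statement of stub G for
  `h : <the fact>`): the fact IS the registered statement, so the reduction is definitional.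

It introduces no other definition, no `sorry`, no new hypothesis on the stub besides the single
named fact, and SUPPORTS stmt-BirchSwinnertonDyer-17609 (it neither closes the item nor lands the
stub G under its registered hypothesis-free name). Nothing shaped like the crux `EdgeCap`, like the neighbouring
stubs M (`stub_membersExist`), L (`stub_padicLFunctionNeZero`), A2 (`stub_arcDivisibility`), or
like the general Greenberg–Stevens theorem is stated.

References: R. Greenberg, G. Stevens, *`p`-adic `L`-functions and `p`-adic periods of modular
forms*, Invent. Math. 111 (1993) 407–447, Thm. 5.15 [GreenbergStevens1993]; K. Kitagawa, *On
standard `p`-adic `L`-functions of families of elliptic cusp forms*, Contemp. Math. 165 (1994)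
81–110, Thm. 1.1, Lemma 5.11, Prop. 5.12 [Kitagawa1994]; D. Delbourgo, *Elliptic Curves and Big
Galois Representations*, LMS Lecture Note Ser. 356, CUP 2008, §4.2 (p. 90, Thm. 4.4), §4.3
(Def. 4.5, Cor. 4.8, remark p. 96, Def. 4.9, Prop. 4.10), §4.4 (Thm. 4.11, Def. 4.12, p. 100)
[Delbourgo2008]; H. Hida, Invent. Math. 85 (1986) 545–613 and Ann. Sci. ÉNS 19 (1986) 231–273
[Hida1986]; B. Mazur, J. Tate, J. Teitelbaum, Invent. Math. 84 (1986) 1–48, §I.10–I.14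
[MazurTateTeitelbaum1986Invent]; A. Wiles, Invent. Math. 94 (1988), Thm. 2.1.4 [Wiles1988];
G. Shimura, Math. Ann. 229 (1977) [Shimura1977]; V. Paşol, A. A. Popa, Proc. LMS 107 (2013),
Cor. 5.12 [PasolPopa2013].
-/

-- D-0017: single-problem summit, so `Summit.BirchSwinnertonDyer.BirchSwinnertonDyer.…` repeats a
-- namespace BY DESIGN.
set_option linter.dupNamespace false

noncomputable section

namespace Summit.BirchSwinnertonDyer.BirchSwinnertonDyer.Theorems

/-- **Stub G (`stub_twoVariableInterpolation`) of line `ratio_measure_strassmann` (v7) for crux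
`TangentCone.EdgeCap` (stmt-BirchSwinnertonDyer-17609), from the Greenberg–Stevens / Kitagawa named
fact — verbatim after the hypothesis.** Assume `greenbergStevens_kitagawa_twoVariable_interpolation`
(Greenberg–Stevens 1993, Thm. 5.15; Kitagawa 1994, Thm. 1.1, Prop. 5.12; Delbourgo 2008, Thm. 4.11,
Def. 4.12, Def. 4.9, Prop. 4.10, p. 100; Hida 1986; Mazur–Tate–Teitelbaum 1986, §I.14). Then for
every globally minimal `W` (elliptic, `N = W.conductorNorm ℤ ≠ 0`), every prime `p ≥ 5` of good
ordinary reduction with surjective mod-`p` representation, under the isolation hypothesis (Br),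
there is an integral `F ∈ ℚ_p⟦X, Y⟧` whose weight-`2` fibre `F(0, T)` is a non-zero `ℚ_p`-multiple
of `padicLFunction f (unitRoot W p)` for the newform `f` of `W`, and which at every
`(k, n)` — `k > 2`, `(p−1) ∣ (k−2)`; `n` odd, `0 < n`, `2n < k`, `(p−1) ∣ (n−1)` — and every ordinary
newform `g ∈ S_k(Γ₀(N))` with a congruent `p`-adic embedding `ι` satisfies
`‖F((1+p)^{k−2} − 1, (1+p)^{n−1} − 1)‖ = ‖Ω‖ · ‖(1 − p^{n−1}/α)(1 − p^{k−1−n}/α)‖ · ‖ι(iⁿΛ(g,n)/ω)‖`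
for a `p`-adic period `Ω ≠ 0`, the `ι`-adic unit root `α ≡ a_p(E)` of `X² − a_p(g)X + p^{k−1}`
and a complex period `ω ≠ 0` with `iⁿΛ(g,n)/ω ∈ K_g`. Colon form `fact → (stub G verbatim)`,
registered as a sub-goal stub of the crux item. Proof: the named fact is this statement, so the
reduction is definitional (`fun h => h`). [cite: GreenbergStevens1993, Thm 5.15]
[cite: Kitagawa1994, Thm 1.1 and Prop 5.12]
[cite: Delbourgo2008, Thm 4.11, Def. 4.12, Def. 4.9, Prop. 4.10 (pp. 96–100)] [cite: Hida1986] -/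
theorem stub_twoVariableInterpolation_of_fact :
    Literature.NumberTheory.EllipticCurves.greenbergStevens_kitagawa_twoVariable_interpolation → (∀ (W : WeierstrassCurve ℚ) [W.IsElliptic] [W.IsGloballyMinimal] (_ : NeZero (W.conductorNorm ℤ)) (p : ℕ)
      [Fact p.Prime], 5 ≤ p → W.HasGoodReductionAtPrime p → ¬ (p : ℤ) ∣ W.frobeniusTrace p →
      W.HasSurjectiveModNGaloisRep p → (∀ (M : ℕ) (_ : NeZero M) (g :
      CuspForm (CongruenceSubgroup.Gamma0 M) 2) (ι :
      Literature.NumberTheory.EllipticCurves.ModularForms.coeffField g →+* PadicAlgCl p), M ∣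
      W.conductorNorm ℤ * p → Literature.NumberTheory.EllipticCurves.ModularForms.IsNewform0 g → ‖ι
      ⟨(UpperHalfPlane.qExpansion 1 ⇑g).coeff p,
      Literature.NumberTheory.EllipticCurves.ModularForms.coeff_mem_coeffField g p⟩‖ = 1 → (∀ ℓ : ℕ, ℓ.Prime
      → ¬ ℓ ∣ W.conductorNorm ℤ * p → ‖ι ⟨(UpperHalfPlane.qExpansion 1 ⇑g).coeff ℓ,
      Literature.NumberTheory.EllipticCurves.ModularForms.coeff_mem_coeffField g ℓ⟩ - ((W.frobeniusTrace ℓ :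
      ℤ) : PadicAlgCl p)‖ < 1) → M = W.conductorNorm ℤ ∧ ∀ n : ℕ, (UpperHalfPlane.qExpansion 1 ⇑g).coeff n =
      ((W.LFunction n : ℤ) : ℂ)) →
      ∃ F : MvPowerSeries (Fin 2) ℚ_[p], Literature.NumberTheory.EllipticCurves.IsPadicInt F ∧
        (∀ f : CuspForm (CongruenceSubgroup.Gamma0 (W.conductorNorm ℤ)) 2,
          Literature.NumberTheory.EllipticCurves.ModularForms.IsNewformOf W f →
          ∃ c : ℚ_[p], c ≠ 0 ∧ ∀ i : ℕ, MvPowerSeries.coeff (Finsupp.single 1 i) F =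
            c * PowerSeries.coeff i (Literature.NumberTheory.EllipticCurves.padicLFunction f
              (Literature.NumberTheory.EllipticCurves.unitRoot W p : ℚ_[p]))) ∧
        (∀ (k : ℤ) (g : CuspForm (CongruenceSubgroup.Gamma0 (W.conductorNorm ℤ)) k)
          (ι : Literature.NumberTheory.EllipticCurves.ModularForms.coeffField g →+* PadicAlgCl p),
          2 < k → ((p : ℤ) - 1) ∣ (k - 2) →
          Literature.NumberTheory.EllipticCurves.ModularForms.IsNewform0 g →
          ‖ι ⟨(UpperHalfPlane.qExpansion 1 ⇑g).coeff p,
            Literature.NumberTheory.EllipticCurves.ModularForms.coeff_mem_coeffField g p⟩‖ = 1 →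
          (∀ ℓ : ℕ, ℓ.Prime → ¬ ℓ ∣ W.conductorNorm ℤ * p → ‖ι ⟨(UpperHalfPlane.qExpansion 1 ⇑g).coeff ℓ,
            Literature.NumberTheory.EllipticCurves.ModularForms.coeff_mem_coeffField g ℓ⟩ -
              ((W.frobeniusTrace ℓ : ℤ) : PadicAlgCl p)‖ < 1) →
          ∃ (Ω α : PadicAlgCl p) (ω : ℂ), Ω ≠ 0 ∧ ω ≠ 0 ∧ ‖α‖ = 1 ∧
            α ^ 2 - ι ⟨(UpperHalfPlane.qExpansion 1 ⇑g).coeff p,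
              Literature.NumberTheory.EllipticCurves.ModularForms.coeff_mem_coeffField g p⟩ * α +
              (p : PadicAlgCl p) ^ (k - 1).toNat = 0 ∧
            ‖α - ((W.frobeniusTrace p : ℤ) : PadicAlgCl p)‖ < 1 ∧
            ∀ n : ℕ, 0 < n → 2 * (n : ℤ) < k → Odd n → (p - 1) ∣ (n - 1) →
              ∃ hmem : Complex.I ^ n * Literature.NumberTheory.EllipticCurves.ModularForms.completedLValue g n / ω ∈
                  Literature.NumberTheory.EllipticCurves.ModularForms.coeffField g,
                ‖Literature.NumberTheory.EllipticCurves.padicEval₂ F ((1 + (p : ℚ_[p])) ^ (k - 2) - 1)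
                    ((1 + (p : ℚ_[p])) ^ (n - 1) - 1)‖ =
                  ‖Ω‖ * ‖(1 - (p : PadicAlgCl p) ^ (n - 1) / α) * (1 - (p : PadicAlgCl p) ^ ((k - 1).toNat - n) / α)‖ *
                    ‖ι ⟨_, hmem⟩‖)) :=
  fun h => h

end Summit.BirchSwinnertonDyer.BirchSwinnertonDyer.Theorems

end
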